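/-
Copyright (c) 2026. All rights reserved.
Released under Apache 2.0 license as described in the file LICENSE.
Authors: abc-iut cell, statement-typer seat abc-iut-L4-t3 (wave 1; gen 8).
-/
import Literature.AnabelianGeometry.AbsoluteAnabelian.LogFrobeniusIotaEtaSquareGenuineOpen
import HarnessLib

/-!
# [AbsTopIII] Prop 5.8 (vii) / Cor 5.10 (iv)(c): composites of the `ι^{An⊢⊞}_{w,ε}` along `Γ⃗×_w`, and the `ι^{An⊢⊞}`-square of Def 5.4 (iii)

S. Mochizuki, *Topics in absolute anabelian geometry III: global reconstruction algorithms*,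
J. Math. Sci. Univ. Tokyo 22 (2015) 939–1156 [MochizukiAbsTopIII2015]; locators `p.N` = pages of the author's
manuscript (`paper:url-5493eb38cbb7`), read on the page: Def 5.4 (iii) p. 126 (`Γ⃗×_non = Γ⃗^⋉_non ∩ Γ⃗^⋊_non`: the
COMMUTATIVE square `𝒪^× ↪ k̄^× → (k̄^×)^pf` / `𝒪^× → k~ ↪ (k̄^×)^pf`), (v) p. 127 (`Γ⃗×_arc`: the single shell-arrow), Prop 5.8
(ii) p. 139 ("determined by the diagram of Definition 5.4, (iii)"), (vii) p. 142 l. 11–17 (`ι^{An⊢⊞}_{w,ε}` for each EDGE of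
`Γ⃗×_w`), Cor 5.10 (iv)(c) p. 148 l. 39–51 ("the homotopies on `D_{An⊢}` arising from the `ι^{An⊢⊞}_{v,ε}` … generate a contact
structure `ℋ_{An⊢}`"), §0 p. 26 / Def 3.5 (ii) p. 75 (a family of homotopies is closed under composition of pairs and carries
ONE homotopy per pair).

WHY THIS FILE (first brick of the L4-lead's «F-0139″-CLOSER»; proof-side support over this lineage's add-on `IotaAnMono`,
nothing restated).  A contact structure containing the `ι^{An⊢⊞}`-pairs `([φ_{ν₁}], [φ_{ν₂}])` (`Cor510MonoTelecorePinnedIota`,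
`LogFrobeniusMonoTelecorePinnedIota.lean`) contains, by transitivity of its boundary set, the pair `([φ_{ν₁}], [φ_{ν₃}])` for
every vertex `ν₃` REACHABLE from `ν₁` in `Γ⃗×_v`, with homotopy the COMPOSITE of the `ι^{An⊢⊞}` along the way — and ONE such
homotopy per pair, whichever way is taken.  Hence the data a closer must supply and the law it must satisfy:

* `LogVertex.Reach ν₁ ν₂` — reachability in `Γ⃗×_v` (reflexive–transitive closure of its edges; a decidable table on the
  six nonarchimedean / four archimedean vertices), with `refl`, `trans`, `of_inCore`, `isCross_src/_tgt` (only vertices of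
  `Γ⃗×_v` are reachable from vertices of `Γ⃗×_v`);
* `LogVertex.reachChain b F ιF ν₁ ν₂ h` — the composite of edge data `ιF` along `ν₁ ⤳ ν₂`, for ANY family `F` on the vertices of
  `Γ⃗×_v` and ANY edge data (generic in the Boolean `b`, so that it applies to `b := isArc w` without transport); laws
  `reachChain_refl`, `reachChain_inCore` (an edge gives its own datum), `reachChain_trans` — the last one UNDER
  `LogVertex.SquaresCommuteF` (the two 2-chains `𝒪^× → k̄^× → (k̄^×)^pf`, `𝒪^× → k~ → (k̄^×)^pf` compose equally; vacuous at an
  archimedean place), which is exactly what makes "the composite along `ν₁ ⤳ ν₃`" independent of the way;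
* `IotaAnMono.chain I w h`, `IotaAnMono.SquaresCommute I` — the instances for this lineage's `ι^{An⊢⊞}`-data `I`, with the laws
  `chain_refl`, `chain_ι`, `chain_trans`; `SquaresCommute` is a CONDITION on `I` (Def 5.4 (iii) read for `ι^{An⊢⊞}`; print has
  it: "determined by the diagram of Definition 5.4, (iii)", a commutative diagram), necessary for any closer of
  `Cor510MonoTelecorePinnedIota` by one-homotopy-per-pair (`squaresCommute_of_multiplicative`: any assignment of homotopies to
  the reachable pairs that extends the `ι^{An⊢⊞}` and composes along reachability forces the square);
* ★ `squaresCommute_genuineOpen` — **it HOLDS at the genuine open-augmentation carrier** (abc-iut-w5-d053 / abc-iut-w4-d095's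
  `nonarchGenuineMonoAnPfOpen_iotaAnMono`): both composites send a unit `u ∈ 𝒪^×_k̄` to its class `[u] ∈ k̄^× ⧸ μ` (abc-iut-f-101's
  torsion-quotient containers), on Galois groups both are the identity.

MODEL-LEVEL where an instance is named; refereed pre-IUT material; nothing here bears on [IUTchIII] Cor. 3.12; OUR kernel
check, no side taken; typed ≠ proved elsewhere.
-/

set_option autoImplicit false

universe u

open CategoryTheory

namespace Literature.AnabelianGeometry.AbsoluteAnabelian

/-! ## Reachability in `Γ⃗×_v` -/

/-- reachability in `Γ⃗×_non` (vertices `𝒪^×`, `k̄^×`, `k~`, `(k̄^×)^pf`; reflexive–transitive closure of its four arrows), as a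
table. [cite: MochizukiAbsTopIII2015, Def 5.4 (iii) p. 126] -/
def NonarchVertex.reach : NonarchVertex → NonarchVertex → Bool
  | .units, .units => true
  | .units, .mult => true
  | .units, .shellCod => true
  | .units, .perf => true
  | .mult, .mult => true
  | .mult, .perf => true
  | .shellCod, .shellCod => true
  | .shellCod, .perf => true
  | .perf, .perf => true
  | _, _ => false

/-- reachability in `Γ⃗×_arc` (vertices `k~`, `k^×`; the single shell-arrow). [cite: MochizukiAbsTopIII2015, Def 5.4 (v) p. 127] -/
def ArchVertex.reach : ArchVertex → ArchVertex → Bool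
  | .pre, .pre => true
  | .pre, .mult => true
  | .mult, .mult => true
  | _, _ => false

/-- reachability in `Γ⃗×_v`, both kinds of place, as a table. [cite: MochizukiAbsTopIII2015, Def 5.4 (iii) p. 126] -/
def LogVertex.reach : {b : Bool} → LogVertex b → LogVertex b → Bool
  | false, ν₁, ν₂ => NonarchVertex.reach ν₁ ν₂
  | true, ν₁, ν₂ => ArchVertex.reach ν₁ ν₂

/-- **`ν₁ ⤳ ν₂` in `Γ⃗×_v`**: `ν₂` is reachable from `ν₁` along edges of `Γ⃗×_v` (including `ν₁ = ν₂` a vertex of `Γ⃗×_v`).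
[cite: MochizukiAbsTopIII2015, Def 5.4 (iii) p. 126] -/
def LogVertex.Reach {b : Bool} (ν₁ ν₂ : LogVertex b) : Prop := LogVertex.reach ν₁ ν₂ = true

/-- reachability is decidable (a table). [cite: MochizukiAbsTopIII2015, Def 5.4 (iii) p. 126] -/
instance LogVertex.Reach.decidable {b : Bool} (ν₁ ν₂ : LogVertex b) : Decidable (ν₁.Reach ν₂) :=
  inferInstanceAs (Decidable (LogVertex.reach ν₁ ν₂ = true))

namespace LogVertex.Reach

/-- only vertices of `Γ⃗×_v` reach anything: the source of `ν₁ ⤳ ν₂` is a vertex of `Γ⃗×_v`. [cite: MochizukiAbsTopIII2015, Def 5.4 (iii) p. 126] -/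
theorem isCross_src : ∀ {b : Bool} {ν₁ ν₂ : LogVertex b}, ν₁.Reach ν₂ → ν₁.IsCross := by
  intro b ν₁ ν₂ h
  cases b <;> cases ν₁ <;> cases ν₂ <;> first | exact absurd h (by decide) | exact ⟨rfl, rfl⟩

/-- … and so is its target. [cite: MochizukiAbsTopIII2015, Def 5.4 (iii) p. 126] -/
theorem isCross_tgt : ∀ {b : Bool} {ν₁ ν₂ : LogVertex b}, ν₁.Reach ν₂ → ν₂.IsCross := by
  intro b ν₁ ν₂ h
  cases b <;> cases ν₁ <;> cases ν₂ <;> first | exact absurd h (by decide) | exact ⟨rfl, rfl⟩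

/-- every vertex of `Γ⃗×_v` reaches itself. [cite: MochizukiAbsTopIII2015, Def 5.4 (iii) p. 126] -/
theorem refl : ∀ {b : Bool} {ν : LogVertex b}, ν.IsCross → ν.Reach ν := by
  intro b ν h
  cases b <;> cases ν <;> first | rfl | exact absurd h.1 (by decide) | exact absurd h.2 (by decide)

/-- an edge of `Γ⃗×_v` reaches its target from its source. [cite: MochizukiAbsTopIII2015, Def 5.4 (iii) p. 126] -/
theorem of_inCore : ∀ {b : Bool} {ν₁ ν₂ : LogVertex b} {ε : LogEdgeTS b ν₁ ν₂}, ε.InCore → ν₁.Reach ν₂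
  | false, _, _, NonarchEdge.unitsToMult, _ => rfl
  | false, _, _, NonarchEdge.multToSpaceLink, h => (NonarchEdge.not_inCore.1 h).elim
  | false, _, _, NonarchEdge.shell, _ => rfl
  | false, _, _, NonarchEdge.multToPerf, _ => rfl
  | false, _, _, NonarchEdge.postLogId, h => (NonarchEdge.not_inCore.2 h).elim
  | false, _, _, NonarchEdge.shellCodToPerf, _ => rfl
  | true, _, _, ArchEdge.postLogId, h => (h.2).elim
  | true, _, _, ArchEdge.shell, _ => rfl
  | true, _, _, ArchEdge.multToSpaceLink, h => (h.1).elim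

/-- reachability is transitive. [cite: MochizukiAbsTopIII2015, Def 5.4 (iii) p. 126] -/
theorem trans : ∀ {b : Bool} {ν₁ ν₂ ν₃ : LogVertex b}, ν₁.Reach ν₂ → ν₂.Reach ν₃ → ν₁.Reach ν₃ := by
  intro b ν₁ ν₂ ν₃ h₁₂ h₂₃
  cases b <;> cases ν₁ <;> cases ν₂ <;> (try exact absurd h₁₂ (by decide)) <;> cases ν₃ <;>
    first | exact absurd h₂₃ (by decide) | rfl

end LogVertex.Reach

/-! ## Composites of edge data along reachability -/

section Chain

variable {C : Type*} [Category C]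

/-- **The composite of edge data along `ν₁ ⤳ ν₂`** for a family `F` on the vertices of `Γ⃗×_v` and data `ιF` on its edges:
identity on the diagonal, the datum of the edge for an edge, the composite `𝒪^× → k̄^× → (k̄^×)^pf` for the one pair joined only
by 2-chains (whose other 2-chain `𝒪^× → k~ → (k̄^×)^pf` agrees with it under `SquaresCommuteF`); generic in the Boolean kind of
place. [cite: MochizukiAbsTopIII2015, Prop 5.8 (vii) p. 142] -/
def LogVertex.reachChain : (b : Bool) → (F : {ν : LogVertex b // ν.IsCross} → C) →
    (ιF : ∀ {μ₁ μ₂ : LogVertex b} (ε : LogEdgeTS b μ₁ μ₂) (hε : ε.InCore), F ⟨μ₁, hε.isCross_src⟩ ⟶ F ⟨μ₂, hε.isCross_tgt⟩) →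
    (ν₁ ν₂ : LogVertex b) → (h : ν₁.Reach ν₂) → (F ⟨ν₁, h.isCross_src⟩ ⟶ F ⟨ν₂, h.isCross_tgt⟩)
  | false, _, _, NonarchVertex.units, NonarchVertex.units, _ => 𝟙 _
  | false, _, ιF, NonarchVertex.units, NonarchVertex.mult, _ => ιF NonarchEdge.unitsToMult NonarchEdge.inCore_of_ne.1
  | false, _, ιF, NonarchVertex.units, NonarchVertex.shellCod, _ => ιF NonarchEdge.shell NonarchEdge.inCore_shell
  | false, _, ιF, NonarchVertex.units, NonarchVertex.perf, _ =>
      ιF NonarchEdge.unitsToMult NonarchEdge.inCore_of_ne.1 ≫ ιF NonarchEdge.multToPerf NonarchEdge.inCore_of_ne.2.1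
  | false, _, _, NonarchVertex.mult, NonarchVertex.mult, _ => 𝟙 _
  | false, _, ιF, NonarchVertex.mult, NonarchVertex.perf, _ => ιF NonarchEdge.multToPerf NonarchEdge.inCore_of_ne.2.1
  | false, _, _, NonarchVertex.shellCod, NonarchVertex.shellCod, _ => 𝟙 _
  | false, _, ιF, NonarchVertex.shellCod, NonarchVertex.perf, _ =>
      ιF NonarchEdge.shellCodToPerf NonarchEdge.inCore_of_ne.2.2
  | false, _, _, NonarchVertex.perf, NonarchVertex.perf, _ => 𝟙 _
  | false, _, _, NonarchVertex.units, NonarchVertex.spaceLink, h => absurd h (by decide)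
  | false, _, _, NonarchVertex.units, NonarchVertex.postLog, h => absurd h (by decide)
  | false, _, _, NonarchVertex.mult, NonarchVertex.units, h => absurd h (by decide)
  | false, _, _, NonarchVertex.mult, NonarchVertex.spaceLink, h => absurd h (by decide)
  | false, _, _, NonarchVertex.mult, NonarchVertex.postLog, h => absurd h (by decide)
  | false, _, _, NonarchVertex.mult, NonarchVertex.shellCod, h => absurd h (by decide)
  | false, _, _, NonarchVertex.spaceLink, _, h => absurd h.isCross_src.2 (by decide)
  | false, _, _, NonarchVertex.postLog, _, h => absurd h.isCross_src.1 (by decide)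
  | false, _, _, NonarchVertex.shellCod, NonarchVertex.units, h => absurd h (by decide)
  | false, _, _, NonarchVertex.shellCod, NonarchVertex.mult, h => absurd h (by decide)
  | false, _, _, NonarchVertex.shellCod, NonarchVertex.spaceLink, h => absurd h (by decide)
  | false, _, _, NonarchVertex.shellCod, NonarchVertex.postLog, h => absurd h (by decide)
  | false, _, _, NonarchVertex.perf, NonarchVertex.units, h => absurd h (by decide)
  | false, _, _, NonarchVertex.perf, NonarchVertex.mult, h => absurd h (by decide)
  | false, _, _, NonarchVertex.perf, NonarchVertex.spaceLink, h => absurd h (by decide)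
  | false, _, _, NonarchVertex.perf, NonarchVertex.postLog, h => absurd h (by decide)
  | false, _, _, NonarchVertex.perf, NonarchVertex.shellCod, h => absurd h (by decide)
  | true, _, _, ArchVertex.pre, ArchVertex.pre, _ => 𝟙 _
  | true, _, ιF, ArchVertex.pre, ArchVertex.mult, _ => ιF ArchEdge.shell ⟨trivial, trivial⟩
  | true, _, _, ArchVertex.mult, ArchVertex.mult, _ => 𝟙 _
  | true, _, _, ArchVertex.pre, ArchVertex.postLog, h => absurd h (by decide)
  | true, _, _, ArchVertex.pre, ArchVertex.spaceLink, h => absurd h (by decide)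
  | true, _, _, ArchVertex.mult, ArchVertex.pre, h => absurd h (by decide)
  | true, _, _, ArchVertex.mult, ArchVertex.postLog, h => absurd h (by decide)
  | true, _, _, ArchVertex.mult, ArchVertex.spaceLink, h => absurd h (by decide)
  | true, _, _, ArchVertex.postLog, _, h => absurd h.isCross_src.1 (by decide)
  | true, _, _, ArchVertex.spaceLink, _, h => absurd h.isCross_src.2 (by decide)

/-- **The `ι`-square of Def 5.4 (iii)** for edge data `ιF`: the composites along `𝒪^× → k̄^× → (k̄^×)^pf` and
`𝒪^× → k~ → (k̄^×)^pf` agree (the only pair of distinct parallel chains of `Γ⃗×_v`; at an archimedean place there is none).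
[cite: MochizukiAbsTopIII2015, Def 5.4 (iii) p. 126] -/
def LogVertex.SquaresCommuteF : (b : Bool) → (F : {ν : LogVertex b // ν.IsCross} → C) →
    (ιF : ∀ {μ₁ μ₂ : LogVertex b} (ε : LogEdgeTS b μ₁ μ₂) (hε : ε.InCore), F ⟨μ₁, hε.isCross_src⟩ ⟶ F ⟨μ₂, hε.isCross_tgt⟩) →
    Prop
  | false, _, ιF => ιF NonarchEdge.shell NonarchEdge.inCore_shell ≫ ιF NonarchEdge.shellCodToPerf NonarchEdge.inCore_of_ne.2.2 =
      ιF NonarchEdge.unitsToMult NonarchEdge.inCore_of_ne.1 ≫ ιF NonarchEdge.multToPerf NonarchEdge.inCore_of_ne.2.1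
  | true, _, _ => True

variable {b : Bool} (F : {ν : LogVertex b // ν.IsCross} → C)
  (ιF : ∀ {μ₁ μ₂ : LogVertex b} (ε : LogEdgeTS b μ₁ μ₂) (hε : ε.InCore), F ⟨μ₁, hε.isCross_src⟩ ⟶ F ⟨μ₂, hε.isCross_tgt⟩)

/-- on the diagonal the composite is the identity. [cite: MochizukiAbsTopIII2015, Prop 5.8 (vii) p. 142] -/
theorem LogVertex.reachChain_refl {ν : LogVertex b} (h : ν.Reach ν) :
    LogVertex.reachChain b F ιF ν ν h = 𝟙 _ := by
  cases b <;> cases ν <;> first | rfl | exact absurd h (by decide)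

/-- along an edge of `Γ⃗×_v` the composite is the datum of that edge. [cite: MochizukiAbsTopIII2015, Prop 5.8 (vii) p. 142] -/
theorem LogVertex.reachChain_inCore : ∀ {ν₁ ν₂ : LogVertex b} (ε : LogEdgeTS b ν₁ ν₂) (hε : ε.InCore),
    LogVertex.reachChain b F ιF ν₁ ν₂ (LogVertex.Reach.of_inCore hε) = ιF ε hε := by
  cases b
  · intro ν₁ ν₂ ε hε
    cases ε <;> first | rfl | exact (NonarchEdge.not_inCore.1 hε).elim | exact (NonarchEdge.not_inCore.2 hε).elim
  · intro ν₁ ν₂ ε hε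
    cases ε <;> first | rfl | exact (hε.1).elim | exact (hε.2).elim

/-- **composition along reachability is transitive, GIVEN the `ι`-square** (one composite per pair: Def 3.5 (ii)).
[cite: MochizukiAbsTopIII2015, Def 5.4 (iii) p. 126] -/
theorem LogVertex.reachChain_trans (hsq : LogVertex.SquaresCommuteF b F ιF) {ν₁ ν₂ ν₃ : LogVertex b}
    (h₁₂ : ν₁.Reach ν₂) (h₂₃ : ν₂.Reach ν₃) (h₁₃ : ν₁.Reach ν₃) :
    LogVertex.reachChain b F ιF ν₁ ν₂ h₁₂ ≫ LogVertex.reachChain b F ιF ν₂ ν₃ h₂₃ =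
      LogVertex.reachChain b F ιF ν₁ ν₃ h₁₃ := by
  cases b <;> cases ν₁ <;> cases ν₂ <;> (try exact absurd h₁₂ (by decide)) <;> cases ν₃ <;>
    first
      | exact absurd h₂₃ (by decide)
      | exact Category.id_comp _
      | exact Category.comp_id _
      | rfl
      | exact hsq

/-- **induction along reachability**: a property of morphisms between the `F`'s that holds for identities and for every edge
datum and is closed under composition holds for every composite along `ν₁ ⤳ ν₂`. [cite: MochizukiAbsTopIII2015, Prop 5.8 (vii) p. 142] -/
theorem LogVertex.reachChain_induction (P : ∀ ⦃j₁ j₂ : {ν : LogVertex b // ν.IsCross}⦄, (F j₁ ⟶ F j₂) → Prop)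
    (hid : ∀ j, P (𝟙 (F j))) (hcomp : ∀ ⦃j₁ j₂ j₃ : {ν : LogVertex b // ν.IsCross}⦄ (f : F j₁ ⟶ F j₂) (g : F j₂ ⟶ F j₃),
      P f → P g → P (f ≫ g))
    (hι : ∀ ⦃μ₁ μ₂ : LogVertex b⦄ (ε : LogEdgeTS b μ₁ μ₂) (hε : ε.InCore), P (ιF ε hε))
    {ν₁ ν₂ : LogVertex b} (h : ν₁.Reach ν₂) : P (LogVertex.reachChain b F ιF ν₁ ν₂ h) := by
  cases b <;> cases ν₁ <;> cases ν₂ <;>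
    first
      | exact absurd h (by decide)
      | exact hid _
      | exact hcomp _ _ (hι _ _) (hι _ _)
      | exact hι _ _

end Chain

/-! ## The instances for the `ι^{An⊢⊞}`-data of a §5 setting -/

namespace LogFrobeniusSetting

namespace IotaAnMono

variable {Vmod : Type u} {isArc : Vmod → Bool} {L : LogFrobeniusSetting Vmod isArc}
variable {hψ : ∀ (w : Vmod) (j : {ν : LogVertex (isArc w) // ν.IsCross}),
  L.ψAnMono w j ⋙ L.forgetMono w ⋙ L.toEmono w ≅ L.κAnMono.inverse}
variable (I : L.IotaAnMono hψ)

/-- **`ι^{An⊢⊞}` along `ν₁ ⤳ ν₂`**: the composite natural transformation `ψ^{An⊢⊞}_{w,ν₁} ⟶ ψ^{An⊢⊞}_{w,ν₂}` of the `ι^{An⊢⊞}_{w,ε}` along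
the reachability (the homotopy of the pair `([φ_{ν₁}], [φ_{ν₂}])` in any family of homotopies containing the `ι^{An⊢⊞}`-pairs).
[cite: MochizukiAbsTopIII2015, Cor 5.10 (iv)(c) p. 148] -/
def chain (w : Vmod) {ν₁ ν₂ : LogVertex (isArc w)} (h : ν₁.Reach ν₂) :
    L.ψAnMono w ⟨ν₁, h.isCross_src⟩ ⟶ L.ψAnMono w ⟨ν₂, h.isCross_tgt⟩ :=
  LogVertex.reachChain (isArc w) (fun j => L.ψAnMono w j) (fun ε hε => I.ι w ε hε) ν₁ ν₂ h

/-- **The `ι^{An⊢⊞}`-square of Def 5.4 (iii)** (a CONDITION on the data `I`, print's "determined by the [commutative] diagram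
of Definition 5.4, (iii)"): at every place, `ι^{An⊢⊞}_{𝒪^×→k~} ≫ ι^{An⊢⊞}_{k~↪(k̄^×)^pf} = ι^{An⊢⊞}_{𝒪^×↪k̄^×} ≫ ι^{An⊢⊞}_{k̄^×→(k̄^×)^pf}`.
[cite: MochizukiAbsTopIII2015, Def 5.4 (iii) p. 126] -/
def SquaresCommute : Prop :=
  ∀ w : Vmod, LogVertex.SquaresCommuteF (isArc w) (fun j => L.ψAnMono w j) (fun ε hε => I.ι w ε hε)

/-- on the diagonal `ι^{An⊢⊞}` along `ν ⤳ ν` is the identity. [cite: MochizukiAbsTopIII2015, Prop 5.8 (vii) p. 142] -/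
theorem chain_refl (w : Vmod) {ν : LogVertex (isArc w)} (h : ν.Reach ν) : I.chain w h = 𝟙 _ :=
  LogVertex.reachChain_refl _ _ h

/-- along an edge it is `ι^{An⊢⊞}_{w,ε}` itself. [cite: MochizukiAbsTopIII2015, Prop 5.8 (vii) p. 142] -/
theorem chain_ι (w : Vmod) {ν₁ ν₂ : LogVertex (isArc w)} (ε : LogEdgeTS (isArc w) ν₁ ν₂) (hε : ε.InCore) :
    I.chain w (LogVertex.Reach.of_inCore hε) = I.ι w ε hε :=
  LogVertex.reachChain_inCore _ _ ε hε

/-- **transitivity of the composites under the square** (`ι^{An⊢⊞}` along `ν₁ ⤳ ν₂ ⤳ ν₃` is `ι^{An⊢⊞}` along `ν₁ ⤳ ν₃`).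
[cite: MochizukiAbsTopIII2015, Cor 5.10 (iv)(c) p. 148] -/
theorem chain_trans (hsq : I.SquaresCommute) (w : Vmod) {ν₁ ν₂ ν₃ : LogVertex (isArc w)} (h₁₂ : ν₁.Reach ν₂)
    (h₂₃ : ν₂.Reach ν₃) (h₁₃ : ν₁.Reach ν₃) : I.chain w h₁₂ ≫ I.chain w h₂₃ = I.chain w h₁₃ :=
  LogVertex.reachChain_trans _ _ (hsq w) h₁₂ h₂₃ h₁₃

/-- naturality of the composite (it is a natural transformation; recorded componentwise for rewriting).
[cite: MochizukiAbsTopIII2015, Prop 5.8 (vii) p. 142] -/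
theorem chain_naturality (w : Vmod) {ν₁ ν₂ : LogVertex (isArc w)} (h : ν₁.Reach ν₂) {X Y : L.AnMono} (f : X ⟶ Y) :
    (L.ψAnMono w ⟨ν₁, h.isCross_src⟩).map f ≫ (I.chain w h).app Y =
      (I.chain w h).app X ≫ (L.ψAnMono w ⟨ν₂, h.isCross_tgt⟩).map f :=
  (I.chain w h).naturality f

/-- **`ι^{An⊢⊞}` along `ν₁ ⤳ ν₂` lies over the identity of `Th⊢[Z]`** (from `ι_over` edge by edge): its image under
`𝒩⊢⊞_w → 𝒩⊢_w → ℰ⊢` is `hψ_{ν₁} ≫ hψ_{ν₂}⁻¹` at every object. [cite: MochizukiAbsTopIII2015, Prop 5.8 (vii) p. 142] -/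
theorem chain_over (w : Vmod) {ν₁ ν₂ : LogVertex (isArc w)} (h : ν₁.Reach ν₂) (X : L.AnMono) :
    (L.toEmono w).map ((L.forgetMono w).map ((I.chain w h).app X)) =
      (hψ w ⟨ν₁, h.isCross_src⟩).hom.app X ≫ (hψ w ⟨ν₂, h.isCross_tgt⟩).inv.app X := by
  refine LogVertex.reachChain_induction (b := isArc w) (fun j => L.ψAnMono w j) (fun ε hε => I.ι w ε hε)
    (fun j₁ j₂ f => ∀ X : L.AnMono,
      (L.toEmono w).map ((L.forgetMono w).map (f.app X)) = (hψ w j₁).hom.app X ≫ (hψ w j₂).inv.app X)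
    (fun j X => ?_) (fun j₁ j₂ j₃ f g hf hg X => ?_) (fun μ₁ μ₂ ε hε X => I.ι_over w ε hε X) h X
  · rw [NatTrans.id_app, CategoryTheory.Functor.map_id, CategoryTheory.Functor.map_id, Iso.hom_inv_id_app]
    rfl
  · rw [NatTrans.comp_app, Functor.map_comp, Functor.map_comp, hf X, hg X]
    erw [Category.assoc, Iso.inv_hom_id_app_assoc]
    rfl

/-- **One homotopy per pair forces the square**: if two 2-chains of `ι^{An⊢⊞}`'s with the same endpoints are both composites
"along `𝒪^× ⤳ (k̄^×)^pf`" of ONE family — formally: if some assignment `θ` of a natural transformation to every reachable pair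
extends the `ι^{An⊢⊞}` on edges and is multiplicative along reachability — then `SquaresCommute` holds (the necessity of the
law for any closer of `Cor510MonoTelecorePinnedIota`). [cite: MochizukiAbsTopIII2015, Def 3.5 (ii) p. 75] -/
theorem squaresCommute_of_multiplicative
    (θ : ∀ (w : Vmod) {ν₁ ν₂ : LogVertex (isArc w)} (h : ν₁.Reach ν₂),
      L.ψAnMono w ⟨ν₁, h.isCross_src⟩ ⟶ L.ψAnMono w ⟨ν₂, h.isCross_tgt⟩)
    (hθι : ∀ (w : Vmod) {ν₁ ν₂ : LogVertex (isArc w)} (ε : LogEdgeTS (isArc w) ν₁ ν₂) (hε : ε.InCore),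
      θ w (LogVertex.Reach.of_inCore hε) = I.ι w ε hε)
    (hθ : ∀ (w : Vmod) {ν₁ ν₂ ν₃ : LogVertex (isArc w)} (h₁₂ : ν₁.Reach ν₂) (h₂₃ : ν₂.Reach ν₃) (h₁₃ : ν₁.Reach ν₃),
      θ w h₁₂ ≫ θ w h₂₃ = θ w h₁₃) :
    I.SquaresCommute := by
  intro w
  -- reduce to a statement about a general Boolean kind of place
  suffices key : ∀ (b : Bool) (F : {ν : LogVertex b // ν.IsCross} → (L.AnMono ⥤ L.NmonoPlus w))
      (ιF : ∀ {μ₁ μ₂ : LogVertex b} (ε : LogEdgeTS b μ₁ μ₂) (hε : ε.InCore), F ⟨μ₁, hε.isCross_src⟩ ⟶ F ⟨μ₂, hε.isCross_tgt⟩)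
      (θ' : ∀ {ν₁ ν₂ : LogVertex b} (h : ν₁.Reach ν₂), F ⟨ν₁, h.isCross_src⟩ ⟶ F ⟨ν₂, h.isCross_tgt⟩),
      (∀ {ν₁ ν₂ : LogVertex b} (ε : LogEdgeTS b ν₁ ν₂) (hε : ε.InCore), θ' (LogVertex.Reach.of_inCore hε) = ιF ε hε) →
      (∀ {ν₁ ν₂ ν₃ : LogVertex b} (h₁₂ : ν₁.Reach ν₂) (h₂₃ : ν₂.Reach ν₃) (h₁₃ : ν₁.Reach ν₃),
        θ' h₁₂ ≫ θ' h₂₃ = θ' h₁₃) →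
      LogVertex.SquaresCommuteF b F ιF from
    key (isArc w) _ _ (fun h => θ w h) (fun ε hε => hθι w ε hε) (fun h₁₂ h₂₃ h₁₃ => hθ w h₁₂ h₂₃ h₁₃)
  intro b F ιF θ' hι hmul
  cases b
  · change ιF NonarchEdge.shell _ ≫ ιF NonarchEdge.shellCodToPerf _ = ιF NonarchEdge.unitsToMult _ ≫ ιF NonarchEdge.multToPerf _
    rw [← hι NonarchEdge.shell NonarchEdge.inCore_shell, ← hι NonarchEdge.shellCodToPerf NonarchEdge.inCore_of_ne.2.2,
      ← hι NonarchEdge.unitsToMult NonarchEdge.inCore_of_ne.1, ← hι NonarchEdge.multToPerf NonarchEdge.inCore_of_ne.2.1]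
    have h₁₃ : LogVertex.Reach (b := false) NonarchVertex.units NonarchVertex.perf := rfl
    exact (hmul _ _ h₁₃).trans (hmul _ _ h₁₃).symm
  · trivial

end IotaAnMono

/-! ## The square HOLDS at the genuine open-augmentation carrier -/

open AbsTopIII

variable (p : ℕ) [Fact p.Prime] (Vmod : Type 1)

/-- ★ **The `ι^{An⊢⊞}`-square holds for the GENUINE data** (abc-iut-w5-d053 / abc-iut-w4-d095's `nonarchGenuineMonoAnPfOpen_iotaAnMono`
over abc-iut-f-101's perfected containers): on Galois groups every `ι^{An⊢⊞}` is the identity, on arithmetic data both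
composites `𝒪^× → 𝒪^× ⧸ μ ↪ k̄^× ⧸ μ` and `𝒪^× ↪ k̄^× → k̄^× ⧸ μ` send `u` to `[u]`. [cite: MochizukiAbsTopIII2015, Def 5.4 (iii) p. 126] -/
theorem squaresCommute_genuineOpen :
    (nonarchGenuineMonoAnPfOpen_iotaAnMono p Vmod (fun _ => false)).SquaresCommute := by
  intro w
  change Up.liftT (MLFClosure.ιMonoPf false NonarchEdge.shell NonarchEdge.inCore_shell) ≫
      Up.liftT (MLFClosure.ιMonoPf false NonarchEdge.shellCodToPerf NonarchEdge.inCore_of_ne.2.2) =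
    Up.liftT (MLFClosure.ιMonoPf false NonarchEdge.unitsToMult NonarchEdge.inCore_of_ne.1) ≫
      Up.liftT (MLFClosure.ιMonoPf false NonarchEdge.multToPerf NonarchEdge.inCore_of_ne.2.1)
  refine NatTrans.ext (funext fun X => ?_)
  apply InducedCategory.hom_ext
  apply Prod.hom_ext
  · rfl
  · exact TSObj.Hom.ext (MonoidHom.ext fun σ => rfl) (funext fun x => rfl)

end LogFrobeniusSetting

end Literature.AnabelianGeometry.AbsoluteAnabelian
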